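import Summits.Langlands.Langlands.Theses.PhantomRMYoshida
import HarnessLib

/-!
# BIRTH SKELETON — piece B `GaloisToAutomorphicOfDatum` of the split of `PhantomRMYoshida.PhantomRMJunction`
(stmt-Langlands-13643). Crux-strategist planner-cstrat-stmt-Langlands-13643-r1-0, 2026-08-17.

`B′ := ∀ F, Nonempty (ReciprocityData F) → ∃ Rec, ∀ n>0 hcpt, GaloisToAutomorphic n Rec hcpt` — direction (B)
(Fontaine–Mazur 1995 Conj 1 + Langlands; Taylor 2004 Conj 8) for SOME pinned datum, all `n`, all number fields.
Stubs (texts of the shared leaves B_w / LGC of the sub's frame lines, the `∃ Rec` guarded by non-vacuity):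
* `stub_weakAutomorphy` (B_w) — every irreducible pinned-geometric `ρ` is weakly cuspidal automorphic (a.e.
  Satake–Frobenius matching with an L-algebraic cuspidal `π`; `Rec`-free; the open core of (B));
* `stub_pairCompatibility` (LGC_∃) — as in the A′ skeleton (shared stub text).
Composition `galoisToAutomorphicOfDatum_text_of` (sorry-free outside the two stubs); the by-name
`GaloisToAutomorphicOfDatum_proof` is appended once the split has written the child decl.
-/

noncomputable section

set_option linter.dupNamespace false

open scoped MatrixGroups NumberField
open NumberField IsDedekindDomain Filter
open Literature.NumberTheory.Automorphic Literature.NumberTheory.GaloisRepresentations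
open Summit.Langlands

namespace Summit.Langlands.Langlands.Cruxes.PhantomRMJunction.BirthB

/-- **Stub B_w — weak automorphy of irreducible pinned-geometric representations** (Fontaine–Mazur–Langlands,
a.e. form; `Rec`-free). [cite: FontaineMazurGeometric1995, Conj. 1] [cite: BuzzardGeeLMS2014, Conj. 3.2.2] -/
theorem stub_weakAutomorphy :
    ∀ (K : Type) [Field K] [NumberField K] (n : ℕ) (hcpt : Literature.NumberTheory.Automorphic.isCompact_glFiniteIntegralLevel n K), 0 < n → ∀ (ℓ : ℕ) [Fact ℓ.Prime] (ι : PadicAlgCl ℓ ≃+* ℂ) (ρ : Literature.NumberTheory.GaloisRepresentations.FramedGaloisRep K (PadicAlgCl ℓ) n), ρ.toGaloisRep.IsIrreducible → ((∀ᶠ v : IsDedekindDomain.HeightOneSpectrum (NumberField.RingOfIntegers K) in Filter.cofinite, ρ.IsUnramifiedAt v) ∧ ∀ (v : IsDedekindDomain.HeightOneSpectrum (NumberField.RingOfIntegers K)) (hv : ((ℓ : ℕ) : NumberField.RingOfIntegers K) ∈ v.asIdeal), (Literature.NumberTheory.PAdicHodge.fontainePstAdicCompletion v ℓ hv).IsDeRhamFramed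 (ρ.toLocal v)) → ∃ π : Literature.NumberTheory.Automorphic.CuspidalAutomorphicRepData n K hcpt, π.1.IsLAlgebraic ∧ ∀ᶠ v : IsDedekindDomain.HeightOneSpectrum (NumberField.RingOfIntegers K) in Filter.cofinite, Summit.Langlands.SatakeFrobCompatibleAt ι π.1 ρ v := by
  sorry

/-- **Stub LGC_∃** (shared with the A′ skeleton). [cite: TaylorGaloisRepresentations2004, Conj. 7] -/
theorem stub_pairCompatibility :
    ∀ (K : Type) [Field K] [NumberField K], Nonempty (Summit.Langlands.ReciprocityData K) → ∃ Rec : Summit.Langlands.ReciprocityData K, ∀ (n : ℕ) (hcpt : Literature.NumberTheory.Automorphic.isCompact_glFiniteIntegralLevel n K), 0 < n → ∀ (π : Literature.NumberTheory.Automorphic.CuspidalAutomorphicRepData n K hcpt), π.1.IsLAlgebraic → ∀ (ℓ : ℕ) [Fact ℓ.Prime] (ι : PadicAlgCl ℓ ≃+* ℂ) (ρ : Literature.NumberTheory.GaloisRepresentations.FramedGaloisRep K (PadicAlgCl ℓ) n), ρ.toGaloisRep.IsIrreducible → ((∀ᶠ v : IsDedekindDomain.HeightOneSpectrum (NumberField.RingOfIntegers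 K) in Filter.cofinite, ρ.IsUnramifiedAt v) ∧ ∀ (v : IsDedekindDomain.HeightOneSpectrum (NumberField.RingOfIntegers K)) (hv : ((ℓ : ℕ) : NumberField.RingOfIntegers K) ∈ v.asIdeal), (Literature.NumberTheory.PAdicHodge.fontainePstAdicCompletion v ℓ hv).IsDeRhamFramed (ρ.toLocal v)) → (∀ᶠ v : IsDedekindDomain.HeightOneSpectrum (NumberField.RingOfIntegers K) in Filter.cofinite, Summit.Langlands.SatakeFrobCompatibleAt ι π.1 ρ v) → ∀ v : IsDedekindDomain.HeightOneSpectrum (NumberField.RingOfIntegers K), Summit.Langlands.LocalGlobalCompatibleAt Rec ι π.1 ρ v := by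
  sorry

/-- **B′ from the stub STATEMENTS**, concluding the TEXT of the piece. -/
theorem galoisToAutomorphicOfDatum_text_of
    (hB : ∀ (K : Type) [Field K] [NumberField K] (n : ℕ) (hcpt : Literature.NumberTheory.Automorphic.isCompact_glFiniteIntegralLevel n K), 0 < n → ∀ (ℓ : ℕ) [Fact ℓ.Prime] (ι : PadicAlgCl ℓ ≃+* ℂ) (ρ : Literature.NumberTheory.GaloisRepresentations.FramedGaloisRep K (PadicAlgCl ℓ) n), ρ.toGaloisRep.IsIrreducible → ((∀ᶠ v : IsDedekindDomain.HeightOneSpectrum (NumberField.RingOfIntegers K) in Filter.cofinite, ρ.IsUnramifiedAt v) ∧ ∀ (v : IsDedekindDomain.HeightOneSpectrum (NumberField.RingOfIntegers K)) (hv : ((ℓ : ℕ) : NumberField.RingOfIntegers K) ∈ v.asIdeal), (Literature.NumberTheory.PAdicHodge.fontainePstAdicCompletion v ℓ hv).IsDeRhamFramed (ρ.toLocal v)) → ∃ π : Literature.NumberTheory.Automorphic.CuspidalAutomorphicRepData n K hcpt, π.1.IsLAlgebraic ∧ ∀ᶠ v : IsDedekindDomain.HeightOneSpectrum (NumberField.RingOfIntegers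 K) in Filter.cofinite, Summit.Langlands.SatakeFrobCompatibleAt ι π.1 ρ v)
    (hL : ∀ (K : Type) [Field K] [NumberField K], Nonempty (Summit.Langlands.ReciprocityData K) → ∃ Rec : Summit.Langlands.ReciprocityData K, ∀ (n : ℕ) (hcpt : Literature.NumberTheory.Automorphic.isCompact_glFiniteIntegralLevel n K), 0 < n → ∀ (π : Literature.NumberTheory.Automorphic.CuspidalAutomorphicRepData n K hcpt), π.1.IsLAlgebraic → ∀ (ℓ : ℕ) [Fact ℓ.Prime] (ι : PadicAlgCl ℓ ≃+* ℂ) (ρ : Literature.NumberTheory.GaloisRepresentations.FramedGaloisRep K (PadicAlgCl ℓ) n), ρ.toGaloisRep.IsIrreducible → ((∀ᶠ v : IsDedekindDomain.HeightOneSpectrum (NumberField.RingOfIntegers K) in Filter.cofinite, ρ.IsUnramifiedAt v) ∧ ∀ (v : IsDedekindDomain.HeightOneSpectrum (NumberField.RingOfIntegers K)) (hv : ((ℓ : ℕ) : NumberField.RingOfIntegers K) ∈ v.asIdeal), (Literature.NumberTheory.PAdicHodge.fontainePstAdicCompletion v ℓ hv).IsDeRhamFramed (ρ.toLocal v)) →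 (∀ᶠ v : IsDedekindDomain.HeightOneSpectrum (NumberField.RingOfIntegers K) in Filter.cofinite, Summit.Langlands.SatakeFrobCompatibleAt ι π.1 ρ v) → ∀ v : IsDedekindDomain.HeightOneSpectrum (NumberField.RingOfIntegers K), Summit.Langlands.LocalGlobalCompatibleAt Rec ι π.1 ρ v) :
    ∀ (F : Type) [Field F] [NumberField F], Nonempty (Summit.Langlands.ReciprocityData F) → ∃ Rec : Summit.Langlands.ReciprocityData F, ∀ n : ℕ, 0 < n → ∀ hcpt : Literature.NumberTheory.Automorphic.isCompact_glFiniteIntegralLevel n F, Summit.Langlands.GaloisToAutomorphic n Rec hcpt := by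
  intro F _ _ hne
  obtain ⟨Rec, hRec⟩ := hL F hne
  refine ⟨Rec, fun n hn hcpt ℓ _ ι ρ hirr hgeo ↦ ?_⟩
  obtain ⟨π, hLalg, hsat⟩ := hB F n hcpt hn ℓ ι ρ hirr hgeo
  exact ⟨π, hLalg, hsat, hRec n hcpt hn π hLalg ℓ ι ρ hirr hgeo hsat⟩

/-- Skeleton composition on the texts (the only sorries are the two stubs). -/
theorem galoisToAutomorphicOfDatum_text_proof :
    ∀ (F : Type) [Field F] [NumberField F], Nonempty (Summit.Langlands.ReciprocityData F) → ∃ Rec : Summit.Langlands.ReciprocityData F, ∀ n : ℕ, 0 < n → ∀ hcpt : Literature.NumberTheory.Automorphic.isCompact_glFiniteIntegralLevel n F, Summit.Langlands.GaloisToAutomorphic n Rec hcpt :=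
  galoisToAutomorphicOfDatum_text_of stub_weakAutomorphy stub_pairCompatibility

end Summit.Langlands.Langlands.Cruxes.PhantomRMJunction.BirthB

end
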